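/-
Copyright (c) 2026. All rights reserved.
Released under Apache 2.0 license as described in the file LICENSE.
Authors: abc-iut cell, seat abc-iut-w6-d109 (gen 2).
-/
import Literature.GroupTheory.TwistedCommutatorWidth

/-!
# Twisted commutator width: absorbing one layer

Second file of the relative Serre argument (`TwistedCommutatorWidth.lean`).  Setting, all inside an
abstract group `G`: normal subgroups `N` (the modulus) and `Q`, a subgroup `U` with
`U ≤ ⟨entries of l⟩`, a list `m` of elements of `Q` such that `Q ≤ ⟨U-conjugates of the entries of m⟩`,
and two normal subgroups `K₁, K₂ ≤ Q` ("the layer `K₁ / N` and the previous layer `K₂`") with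
`⁅K₁, Q⁆ ≤ N` (centrality) and `⁅a, b⁆ ∈ K₁` for `a` in `m`, `b ∈ K₂`.  Write
`S := T(l, K₁) · T(m, K₂)` and say `g` is ABSORBED if `g ≡ s (mod N)` for some `s ∈ S`
(spelled out as `∃ s₁ ∈ T(l, K₁), ∃ s₂ ∈ T(m, K₂), mk g = mk s₁ * mk s₂`; no definition).

* absorbed elements are closed under products, inverses and `Q`-conjugation
  (`exists_wordSet_mk_mul`, `exists_wordSet_mk_inv`, `exists_wordSet_mk_conj`);
* `exists_wordSet_mk_commutator_of_mem` — `⁅u, y⁆` is absorbed for `u ∈ U`, `y ∈ K₁`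
  (induction over words in the `gᵢ`: `⁅uu', y⁆ = ⁅u, u'yu'⁻¹⁆⁅u', y⁆`, `⁅u⁻¹, y⁆ = y⁅u, u⁻¹y⁻¹u⁆y⁻¹`);
* `exists_wordSet_mk_commutator_of_mem_of_conj` — `⁅x, b⁆` is absorbed for `x ∈ Q`, `b ∈ K₂`
  (induction over words in the conjugates: `⁅uau⁻¹, b⁆ = ⁅u, t⁆ · t`, `t = ⁅a, u⁻¹bu⁆`);
* `exists_wordSet_mk_of_mem_commutator` — every element of `⁅K₂, Q⁆` is absorbed;
* `exists_mul_pow_eq_pow_mul` — `(yc)^q = y^q c^q μ` with `μ ∈ ⁅K₂, Q⁆` (`y ∈ Q`, `c ∈ K₂`);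
* `exists_pow_wordSet_mk_of_le` — if moreover `K₁ ≤ ⁅K₂, Q⁆ ⊔ ⟨K₂ ^ q⟩`, every `e ∈ K₁` is
  `≡ c^q · s (mod N)` with `c ∈ K₂`, `s ∈ S`.

[cite: DDMSAnalyticProP1999, Prop 1.19 (proof), Thm 1.17]
-/

namespace Literature.GroupTheory

open scoped Pointwise commutatorElement

variable {G : Type*} [Group G]

section Absorb

variable (N : Subgroup G) [hN : N.Normal] (Q : Subgroup G) [hQ : Q.Normal]
  (l m : List G) (K₁ K₂ : Subgroup G) [hK₁ : K₁.Normal] [hK₂ : K₂.Normal]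

omit hK₁ hK₂ in
/-- `T(m, K₂) ⊆ K₁` when `⁅a, b⁆ ∈ K₁` for `a` in `m`, `b ∈ K₂` (restatement of
`wordSet_subset_of_forall_mem`). [cite: DDMSAnalyticProP1999, Prop 1.19 (proof)] -/
theorem wordSet_subset_of_forall_mem' (hmK : ∀ a ∈ m, ∀ b ∈ K₂, ⁅a, b⁆ ∈ K₁) :
    (m.map fun a => (fun y : G => ⁅a, y⁆) '' (K₂ : Set G)).prod ⊆ (K₁ : Set G) :=
  wordSet_subset_of_forall_mem m hmK

/-- The commutators `⁅a, y⁆`, `y ∈ K₁`, lie in the normal subgroup `K₁`.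
[cite: DDMSAnalyticProP1999, Prop 1.19 (proof)] -/
theorem commutatorElement_mem_of_normal (a : G) {y : G} (hy : y ∈ K₁) : ⁅a, y⁆ ∈ K₁ := by
  rw [commutatorElement_def]; exact K₁.mul_mem (hK₁.conj_mem y hy a) (K₁.inv_mem hy)

omit hK₁ hK₂ in
/-- ONE is absorbed. [cite: DDMSAnalyticProP1999, Prop 1.19 (proof)] -/
theorem exists_wordSet_mk_one :
    ∃ s₁ ∈ (l.map fun a => (fun y : G => ⁅a, y⁆) '' (K₁ : Set G)).prod,
      ∃ s₂ ∈ (m.map fun a => (fun y : G => ⁅a, y⁆) '' (K₂ : Set G)).prod,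
        (QuotientGroup.mk (1 : G) : G ⧸ N) = QuotientGroup.mk s₁ * QuotientGroup.mk s₂ :=
  ⟨1, one_mem_wordSet l K₁, 1, one_mem_wordSet m K₂, by rw [QuotientGroup.mk_one, one_mul]⟩

omit hQ hK₂ in
/-- Absorbed elements commute with `Q` modulo `N`. [cite: DDMSAnalyticProP1999, Prop 1.19 (proof)] -/
theorem mk_mul_mk_comm_of_exists_wordSet (hK₁N : ⁅K₁, Q⁆ ≤ N)
    (hmK : ∀ a ∈ m, ∀ b ∈ K₂, ⁅a, b⁆ ∈ K₁) {g x : G} (hx : x ∈ Q)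
    (hg : ∃ s₁ ∈ (l.map fun a => (fun y : G => ⁅a, y⁆) '' (K₁ : Set G)).prod,
      ∃ s₂ ∈ (m.map fun a => (fun y : G => ⁅a, y⁆) '' (K₂ : Set G)).prod,
        (QuotientGroup.mk g : G ⧸ N) = QuotientGroup.mk s₁ * QuotientGroup.mk s₂) :
    (QuotientGroup.mk x : G ⧸ N) * QuotientGroup.mk g = QuotientGroup.mk g * QuotientGroup.mk x := by
  obtain ⟨s₁, hs₁, s₂, hs₂, hg⟩ := hg
  have h1 := mk_mul_mk_comm_of_mem_wordSet N Q hK₁N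
    (fun a _ k hk => commutatorElement_mem_of_normal K₁ a hk) hs₁ hx
  have h2 := mk_mul_mk_comm_of_mem_wordSet N Q hK₁N hmK hs₂ hx
  rw [hg, ← mul_assoc, h1, mul_assoc, h2, mul_assoc]

omit hK₂ in
/-- PRODUCTS of absorbed elements are absorbed. [cite: DDMSAnalyticProP1999, Prop 1.19 (proof)] -/
theorem exists_wordSet_mk_mul (hK₁N : ⁅K₁, Q⁆ ≤ N) (hK₁Q : K₁ ≤ Q) (hK₂Q : K₂ ≤ Q)
    (hmK : ∀ a ∈ m, ∀ b ∈ K₂, ⁅a, b⁆ ∈ K₁) {g g' : G}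
    (hg : ∃ s₁ ∈ (l.map fun a => (fun y : G => ⁅a, y⁆) '' (K₁ : Set G)).prod,
      ∃ s₂ ∈ (m.map fun a => (fun y : G => ⁅a, y⁆) '' (K₂ : Set G)).prod,
        (QuotientGroup.mk g : G ⧸ N) = QuotientGroup.mk s₁ * QuotientGroup.mk s₂)
    (hg' : ∃ s₁ ∈ (l.map fun a => (fun y : G => ⁅a, y⁆) '' (K₁ : Set G)).prod,
      ∃ s₂ ∈ (m.map fun a => (fun y : G => ⁅a, y⁆) '' (K₂ : Set G)).prod,
        (QuotientGroup.mk g' : G ⧸ N) = QuotientGroup.mk s₁ * QuotientGroup.mk s₂) :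
    ∃ s₁ ∈ (l.map fun a => (fun y : G => ⁅a, y⁆) '' (K₁ : Set G)).prod,
      ∃ s₂ ∈ (m.map fun a => (fun y : G => ⁅a, y⁆) '' (K₂ : Set G)).prod,
        (QuotientGroup.mk (g * g') : G ⧸ N) = QuotientGroup.mk s₁ * QuotientGroup.mk s₂ := by
  obtain ⟨s₁, hs₁, s₂, hs₂, hge⟩ := hg
  obtain ⟨s₁', hs₁', s₂', hs₂', hge'⟩ := hg'
  have hl₁ : ∀ a ∈ l, ∀ k ∈ (K₁ : Set G), ⁅a, k⁆ ∈ K₁ :=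
    fun a _ k hk => commutatorElement_mem_of_normal K₁ a hk
  obtain ⟨w₁, hw₁, hw₁eq⟩ :=
    exists_mk_mul_mk_eq_of_mem_wordSet N Q hK₁N hl₁ (le_refl K₁) hK₁Q hs₁ hs₁'
  obtain ⟨w₂, hw₂, hw₂eq⟩ :=
    exists_mk_mul_mk_eq_of_mem_wordSet N Q hK₁N hmK (le_refl K₂) hK₂Q hs₂ hs₂'
  refine ⟨w₁, hw₁, w₂, hw₂, ?_⟩
  -- `s₂ ∈ T(m, K₂) ⊆ K₁ ⊆ Q` commutes with `s₁' ∈ T(l, K₁)`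
  have hs₂Q : s₂ ∈ Q := hK₁Q (wordSet_subset_of_forall_mem m hmK hs₂)
  have hc := mk_mul_mk_comm_of_mem_wordSet N Q hK₁N hl₁ hs₁' hs₂Q
  rw [QuotientGroup.mk_mul, hge, hge', ← hw₁eq, ← hw₂eq, mul_assoc, mul_assoc,
    ← mul_assoc (QuotientGroup.mk s₂), hc, mul_assoc]

omit hK₂ in
/-- INVERSES of absorbed elements are absorbed. [cite: DDMSAnalyticProP1999, Prop 1.19 (proof)] -/
theorem exists_wordSet_mk_inv (hK₁N : ⁅K₁, Q⁆ ≤ N) (hK₁Q : K₁ ≤ Q) (hK₂Q : K₂ ≤ Q)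
    (hmK : ∀ a ∈ m, ∀ b ∈ K₂, ⁅a, b⁆ ∈ K₁) {g : G}
    (hg : ∃ s₁ ∈ (l.map fun a => (fun y : G => ⁅a, y⁆) '' (K₁ : Set G)).prod,
      ∃ s₂ ∈ (m.map fun a => (fun y : G => ⁅a, y⁆) '' (K₂ : Set G)).prod,
        (QuotientGroup.mk g : G ⧸ N) = QuotientGroup.mk s₁ * QuotientGroup.mk s₂) :
    ∃ s₁ ∈ (l.map fun a => (fun y : G => ⁅a, y⁆) '' (K₁ : Set G)).prod,
      ∃ s₂ ∈ (m.map fun a => (fun y : G => ⁅a, y⁆) '' (K₂ : Set G)).prod,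
        (QuotientGroup.mk g⁻¹ : G ⧸ N) = QuotientGroup.mk s₁ * QuotientGroup.mk s₂ := by
  obtain ⟨s₁, hs₁, s₂, hs₂, hge⟩ := hg
  have hl₁ : ∀ a ∈ l, ∀ k ∈ (K₁ : Set G), ⁅a, k⁆ ∈ K₁ :=
    fun a _ k hk => commutatorElement_mem_of_normal K₁ a hk
  obtain ⟨w₁, hw₁, hw₁eq⟩ := exists_mk_inv_eq_of_mem_wordSet N Q hK₁N hl₁ hK₁Q hs₁
  obtain ⟨w₂, hw₂, hw₂eq⟩ := exists_mk_inv_eq_of_mem_wordSet N Q hK₁N hmK hK₂Q hs₂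
  refine ⟨w₁, hw₁, w₂, hw₂, ?_⟩
  have hw₂Q : w₂ ∈ Q := hK₁Q (wordSet_subset_of_forall_mem m hmK hw₂)
  rw [QuotientGroup.mk_inv, hge, mul_inv_rev, hw₁eq, hw₂eq]
  exact mk_mul_mk_comm_of_mem_wordSet N Q hK₁N hl₁ hw₁ hw₂Q

omit hQ hK₂ in
/-- `Q`-CONJUGATES of absorbed elements are absorbed (indeed congruent).
[cite: DDMSAnalyticProP1999, Prop 1.19 (proof)] -/
theorem exists_wordSet_mk_conj (hK₁N : ⁅K₁, Q⁆ ≤ N)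
    (hmK : ∀ a ∈ m, ∀ b ∈ K₂, ⁅a, b⁆ ∈ K₁) {g x : G} (hx : x ∈ Q)
    (hg : ∃ s₁ ∈ (l.map fun a => (fun y : G => ⁅a, y⁆) '' (K₁ : Set G)).prod,
      ∃ s₂ ∈ (m.map fun a => (fun y : G => ⁅a, y⁆) '' (K₂ : Set G)).prod,
        (QuotientGroup.mk g : G ⧸ N) = QuotientGroup.mk s₁ * QuotientGroup.mk s₂) :
    ∃ s₁ ∈ (l.map fun a => (fun y : G => ⁅a, y⁆) '' (K₁ : Set G)).prod,
      ∃ s₂ ∈ (m.map fun a => (fun y : G => ⁅a, y⁆) '' (K₂ : Set G)).prod,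
        (QuotientGroup.mk (x * g * x⁻¹) : G ⧸ N) = QuotientGroup.mk s₁ * QuotientGroup.mk s₂ := by
  have hc := mk_mul_mk_comm_of_exists_wordSet N Q l m K₁ K₂ hK₁N hmK hx hg
  obtain ⟨s₁, hs₁, s₂, hs₂, hge⟩ := hg
  refine ⟨s₁, hs₁, s₂, hs₂, ?_⟩
  rw [QuotientGroup.mk_mul, QuotientGroup.mk_mul, hc, QuotientGroup.mk_inv, mul_inv_cancel_right,
    hge]

omit hK₁ hK₂ in
/-- Elements of `N` are absorbed. [cite: DDMSAnalyticProP1999, Prop 1.19 (proof)] -/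
theorem exists_wordSet_mk_of_mem {g : G} (hg : g ∈ N) :
    ∃ s₁ ∈ (l.map fun a => (fun y : G => ⁅a, y⁆) '' (K₁ : Set G)).prod,
      ∃ s₂ ∈ (m.map fun a => (fun y : G => ⁅a, y⁆) '' (K₂ : Set G)).prod,
        (QuotientGroup.mk g : G ⧸ N) = QuotientGroup.mk s₁ * QuotientGroup.mk s₂ :=
  ⟨1, one_mem_wordSet l K₁, 1, one_mem_wordSet m K₂, by
    rw [QuotientGroup.mk_one, one_mul, (QuotientGroup.eq_one_iff g).mpr hg]⟩

omit hK₂ in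
/-- **The `gᵢ`-slots absorb `⁅U, K₁⁆`.** If `U ≤ ⟨entries of l⟩`, then for `u ∈ U` and `y ∈ K₁`
the twisted commutator `⁅u, y⁆` is absorbed: `⁅u, y⁆ ≡ ⁅g₁,y₁⁆⋯⁅g_r,y_r⁆ · s₂ (mod N)`.  Induction
over `u` as a word in the `gᵢ` via `⁅uu', y⁆ = ⁅u, u'yu'⁻¹⁆⁅u', y⁆`, `⁅u⁻¹, y⁆ = y⁅u, u⁻¹y⁻¹u⁆y⁻¹`.
[cite: DDMSAnalyticProP1999, Prop 1.19 (proof)] -/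
theorem exists_wordSet_mk_commutator_of_mem (hK₁N : ⁅K₁, Q⁆ ≤ N) (hK₁Q : K₁ ≤ Q)
    (hK₂Q : K₂ ≤ Q) (hmK : ∀ a ∈ m, ∀ b ∈ K₂, ⁅a, b⁆ ∈ K₁) {U : Subgroup G}
    (hl : ∀ u ∈ U, u ∈ Subgroup.closure {a : G | a ∈ l}) {u : G} (hu : u ∈ U) {y : G}
    (hy : y ∈ K₁) :
    ∃ s₁ ∈ (l.map fun a => (fun y : G => ⁅a, y⁆) '' (K₁ : Set G)).prod,
      ∃ s₂ ∈ (m.map fun a => (fun y : G => ⁅a, y⁆) '' (K₂ : Set G)).prod,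
        (QuotientGroup.mk ⁅u, y⁆ : G ⧸ N) = QuotientGroup.mk s₁ * QuotientGroup.mk s₂ := by
  have hu' := hl u hu
  clear hu
  induction hu' using Subgroup.closure_induction generalizing y with
  | mem a ha =>
    exact ⟨⁅a, y⁆, comm_mem_wordSet K₁ ha hy, 1, one_mem_wordSet m K₂, by
      rw [QuotientGroup.mk_one, mul_one]⟩
  | one =>
    rw [commutatorElement_one_left]
    exact exists_wordSet_mk_one N l m K₁ K₂
  | mul u u' _ _ ih ih' =>
    rw [commutatorElement_mul_left_eq]
    exact exists_wordSet_mk_mul N Q l m K₁ K₂ hK₁N hK₁Q hK₂Q hmK (ih (hK₁.conj_mem y hy u'))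
      (ih' hy)
  | inv u _ ih =>
    rw [commutatorElement_inv_left_eq]
    exact exists_wordSet_mk_conj N Q l m K₁ K₂ hK₁N hmK (hK₁Q hy)
      (ih (hK₁.conj_mem' _ (K₁.inv_mem hy) u))

/-- **The `xₖ`-slots absorb `⁅Q, K₂⁆`.** If moreover the entries of `m` lie in `Q` and
`Q ≤ ⟨U-conjugates of the entries of m⟩`, then for `x ∈ Q` and `b ∈ K₂` the commutator `⁅x, b⁆` is
absorbed.  Induction over `x` as a word in the conjugates `uau⁻¹` via `⁅uau⁻¹, b⁆ = ⁅u, t⁆ · t` with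
`t = ⁅a, u⁻¹bu⁆ ∈ T(m, K₂)`. [cite: DDMSAnalyticProP1999, Prop 1.19 (proof)] -/
theorem exists_wordSet_mk_commutator_of_mem_of_conj (hK₁N : ⁅K₁, Q⁆ ≤ N) (hK₁Q : K₁ ≤ Q)
    (hK₂Q : K₂ ≤ Q) (hmK : ∀ a ∈ m, ∀ b ∈ K₂, ⁅a, b⁆ ∈ K₁) {U : Subgroup G}
    (hl : ∀ u ∈ U, u ∈ Subgroup.closure {a : G | a ∈ l})
    (hgen : ∀ x ∈ Q, x ∈ Subgroup.closure {z : G | ∃ u ∈ U, ∃ a ∈ m, z = u * a * u⁻¹})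
    {x : G} (hx : x ∈ Q) {b : G} (hb : b ∈ K₂) :
    ∃ s₁ ∈ (l.map fun a => (fun y : G => ⁅a, y⁆) '' (K₁ : Set G)).prod,
      ∃ s₂ ∈ (m.map fun a => (fun y : G => ⁅a, y⁆) '' (K₂ : Set G)).prod,
        (QuotientGroup.mk ⁅x, b⁆ : G ⧸ N) = QuotientGroup.mk s₁ * QuotientGroup.mk s₂ := by
  have hx' := hgen x hx
  clear hx
  induction hx' using Subgroup.closure_induction generalizing b with
  | mem z hz =>
    obtain ⟨u, hu, a, ha, rfl⟩ := hz
    rw [commutatorElement_conj_left_eq]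
    have hb' : u⁻¹ * b * u ∈ K₂ := hK₂.conj_mem' b hb u
    have ht : ⁅a, u⁻¹ * b * u⁆ ∈ (m.map fun a => (fun y : G => ⁅a, y⁆) '' (K₂ : Set G)).prod :=
      comm_mem_wordSet K₂ ha hb'
    have htK : ⁅a, u⁻¹ * b * u⁆ ∈ K₁ := hmK a ha _ hb'
    refine exists_wordSet_mk_mul N Q l m K₁ K₂ hK₁N hK₁Q hK₂Q hmK
      (exists_wordSet_mk_commutator_of_mem N Q l m K₁ K₂ hK₁N hK₁Q hK₂Q hmK hl hu htK) ?_
    exact ⟨1, one_mem_wordSet l K₁, _, ht, by rw [QuotientGroup.mk_one, one_mul]⟩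
  | one =>
    rw [commutatorElement_one_left]
    exact exists_wordSet_mk_one N l m K₁ K₂
  | mul x x' _ _ ih ih' =>
    rw [commutatorElement_mul_left_eq]
    exact exists_wordSet_mk_mul N Q l m K₁ K₂ hK₁N hK₁Q hK₂Q hmK (ih (hK₂.conj_mem b hb x'))
      (ih' hb)
  | inv x _ ih =>
    rw [commutatorElement_inv_left_eq]
    exact exists_wordSet_mk_conj N Q l m K₁ K₂ hK₁N hmK (hK₂Q hb)
      (ih (hK₂.conj_mem' _ (K₂.inv_mem hb) x))

/-- Every element of `⁅K₂, Q⁆` is absorbed (generators `⁅b, x⁆ = ⁅x, b⁆⁻¹`).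
[cite: DDMSAnalyticProP1999, Prop 1.19 (proof)] -/
theorem exists_wordSet_mk_of_mem_commutator (hK₁N : ⁅K₁, Q⁆ ≤ N) (hK₁Q : K₁ ≤ Q)
    (hK₂Q : K₂ ≤ Q) (hmK : ∀ a ∈ m, ∀ b ∈ K₂, ⁅a, b⁆ ∈ K₁) {U : Subgroup G}
    (hl : ∀ u ∈ U, u ∈ Subgroup.closure {a : G | a ∈ l})
    (hgen : ∀ x ∈ Q, x ∈ Subgroup.closure {z : G | ∃ u ∈ U, ∃ a ∈ m, z = u * a * u⁻¹})
    {g : G} (hg : g ∈ ⁅K₂, Q⁆) :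
    ∃ s₁ ∈ (l.map fun a => (fun y : G => ⁅a, y⁆) '' (K₁ : Set G)).prod,
      ∃ s₂ ∈ (m.map fun a => (fun y : G => ⁅a, y⁆) '' (K₂ : Set G)).prod,
        (QuotientGroup.mk g : G ⧸ N) = QuotientGroup.mk s₁ * QuotientGroup.mk s₂ := by
  rw [Subgroup.commutator_def] at hg
  induction hg using Subgroup.closure_induction with
  | mem z hz =>
    obtain ⟨b, hb, x, hx, rfl⟩ := hz
    rw [← commutatorElement_inv x b]
    exact exists_wordSet_mk_inv N Q l m K₁ K₂ hK₁N hK₁Q hK₂Q hmK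
      (exists_wordSet_mk_commutator_of_mem_of_conj N Q l m K₁ K₂ hK₁N hK₁Q hK₂Q hmK hl hgen hx hb)
  | one => exact exists_wordSet_mk_one N l m K₁ K₂
  | mul z z' _ _ ih ih' => exact exists_wordSet_mk_mul N Q l m K₁ K₂ hK₁N hK₁Q hK₂Q hmK ih ih'
  | inv z _ ih => exact exists_wordSet_mk_inv N Q l m K₁ K₂ hK₁N hK₁Q hK₂Q hmK ih

omit hN hK₁ in
/-- POWERS: for `y ∈ Q` and `c ∈ K₂`, `(yc)^q = y^q c^q μ` for some `μ ∈ ⁅K₂, Q⁆` (the classes of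
`y` and `c` commute modulo `⁅K₂, Q⁆`). [cite: DDMSAnalyticProP1999, Prop 1.19 (proof)] -/
theorem exists_mul_pow_eq_pow_mul (q : ℕ) {y c : G} (hy : y ∈ Q) (hc : c ∈ K₂) :
    ∃ μ ∈ ⁅K₂, Q⁆, (y * c) ^ q = y ^ q * c ^ q * μ := by
  have hcomm : (QuotientGroup.mk y : G ⧸ ⁅K₂, Q⁆) * QuotientGroup.mk c =
      QuotientGroup.mk c * QuotientGroup.mk y :=
    mk_mul_mk_comm_of_commutator_le ⁅K₂, Q⁆ Q (le_refl _) hc hy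
  have h : (QuotientGroup.mk ((y * c) ^ q) : G ⧸ ⁅K₂, Q⁆) = QuotientGroup.mk (y ^ q * c ^ q) := by
    rw [QuotientGroup.mk_pow, QuotientGroup.mk_mul, (Commute.mul_pow hcomm q),
      QuotientGroup.mk_mul, QuotientGroup.mk_pow, QuotientGroup.mk_pow]
  refine ⟨(y ^ q * c ^ q)⁻¹ * (y * c) ^ q, QuotientGroup.eq.mp h.symm, ?_⟩
  rw [mul_inv_cancel_left]

/-- **The power slot.** If `K₁ ≤ ⁅K₂, Q⁆ ⊔ ⟨{c ^ q | c ∈ K₂}⟩`, then every `e ∈ K₁` satisfies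
`e ≡ c^q · s (mod N)` with `c ∈ K₂` and `s` absorbed. [cite: DDMSAnalyticProP1999, Prop 1.19 (proof)] -/
theorem exists_pow_wordSet_mk_of_le (hK₁N : ⁅K₁, Q⁆ ≤ N) (hK₁Q : K₁ ≤ Q)
    (hK₂Q : K₂ ≤ Q) (hmK : ∀ a ∈ m, ∀ b ∈ K₂, ⁅a, b⁆ ∈ K₁) {U : Subgroup G}
    (hl : ∀ u ∈ U, u ∈ Subgroup.closure {a : G | a ∈ l})
    (hgen : ∀ x ∈ Q, x ∈ Subgroup.closure {z : G | ∃ u ∈ U, ∃ a ∈ m, z = u * a * u⁻¹})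
    (q : ℕ) (hK₁le : K₁ ≤ ⁅K₂, Q⁆ ⊔ Subgroup.closure ((fun c : G => c ^ q) '' (K₂ : Set G)))
    {e : G} (he : e ∈ K₁) :
    ∃ c ∈ K₂, ∃ g : G,
      (∃ s₁ ∈ (l.map fun a => (fun y : G => ⁅a, y⁆) '' (K₁ : Set G)).prod,
        ∃ s₂ ∈ (m.map fun a => (fun y : G => ⁅a, y⁆) '' (K₂ : Set G)).prod,
          (QuotientGroup.mk g : G ⧸ N) = QuotientGroup.mk s₁ * QuotientGroup.mk s₂) ∧
      (QuotientGroup.mk e : G ⧸ N) = QuotientGroup.mk (c ^ q) * QuotientGroup.mk g := by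
  have he' := hK₁le he
  clear he
  rw [Subgroup.commutator_def, ← Subgroup.closure_union] at he'
  induction he' using Subgroup.closure_induction with
  | mem z hz =>
    rcases hz with hz | hz
    · have hz' : z ∈ ⁅K₂, Q⁆ := by rw [Subgroup.commutator_def]; exact Subgroup.subset_closure hz
      exact ⟨1, K₂.one_mem, z,
        exists_wordSet_mk_of_mem_commutator N Q l m K₁ K₂ hK₁N hK₁Q hK₂Q hmK hl hgen hz',
        by rw [one_pow, QuotientGroup.mk_one, one_mul]⟩
    · obtain ⟨c, hc, rfl⟩ := hz
      exact ⟨c, hc, 1, exists_wordSet_mk_one N l m K₁ K₂, by rw [QuotientGroup.mk_one, mul_one]⟩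
  | one =>
    exact ⟨1, K₂.one_mem, 1, exists_wordSet_mk_one N l m K₁ K₂,
      by rw [one_pow, QuotientGroup.mk_one, mul_one]⟩
  | mul z z' _ _ ih ih' =>
    obtain ⟨c, hc, g, hg, hzeq⟩ := ih
    obtain ⟨c', hc', g', hg', hz'eq⟩ := ih'
    obtain ⟨μ, hμ, hμeq⟩ := exists_mul_pow_eq_pow_mul Q K₂ q (hK₂Q hc) hc'
    have hμS := exists_wordSet_mk_of_mem_commutator N Q l m K₁ K₂ hK₁N hK₁Q hK₂Q hmK hl hgen hμ
    have hμgS := exists_wordSet_mk_mul N Q l m K₁ K₂ hK₁N hK₁Q hK₂Q hmK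
      (exists_wordSet_mk_inv N Q l m K₁ K₂ hK₁N hK₁Q hK₂Q hmK hμS)
      (exists_wordSet_mk_mul N Q l m K₁ K₂ hK₁N hK₁Q hK₂Q hmK hg hg')
    refine ⟨c * c', K₂.mul_mem hc hc', μ⁻¹ * (g * g'), hμgS, ?_⟩
    -- `g` commutes with `c' ^ q ∈ Q`
    have hcomm := mk_mul_mk_comm_of_exists_wordSet N Q l m K₁ K₂ hK₁N hmK
      (Q.pow_mem (hK₂Q hc') q) hg
    rw [QuotientGroup.mk_mul, hzeq, hz'eq, hμeq]
    simp only [QuotientGroup.mk_mul, QuotientGroup.mk_inv, mul_assoc, mul_inv_cancel_left]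
    rw [← mul_assoc (QuotientGroup.mk g : G ⧸ N) (QuotientGroup.mk (c' ^ q)) (QuotientGroup.mk g'),
      ← hcomm, mul_assoc]
  | inv z _ ih =>
    obtain ⟨c, hc, g, hg, hzeq⟩ := ih
    refine ⟨c⁻¹, K₂.inv_mem hc, g⁻¹, exists_wordSet_mk_inv N Q l m K₁ K₂ hK₁N hK₁Q hK₂Q hmK hg, ?_⟩
    have hcomm := mk_mul_mk_comm_of_exists_wordSet N Q l m K₁ K₂ hK₁N hmK
      (Q.pow_mem (hK₂Q hc) q) hg
    rw [QuotientGroup.mk_inv, hzeq, hcomm, mul_inv_rev, inv_pow, QuotientGroup.mk_inv,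
      QuotientGroup.mk_inv]

end Absorb

end Literature.GroupTheory
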